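import Literature.AlgebraicGeometry.HodgeTheory.MotivatedClassesDeformationInputs
import Literature.AlgebraicGeometry.HodgeTheory.GlobalInvariantCyclesSectionsProofs
import Literature.AlgebraicGeometry.HodgeTheory.DirectImageTransport
import Literature.AlgebraicGeometry.HodgeTheory.HyperplaneSectionMonodromyProofs
import Literature.AlgebraicGeometry.HodgeTheory.MotivatedClassesDeformation
import HarnessLib

/-!
# Crux `HeckePrymAnchors` (stmt-HodgeConjecture-14496), line `Sketch` · stub G2 `stub_rationalAlongSection`

Route `HeckePrymWeil`. **Rationality along a flat section** on the tree's real carriers: for a smooth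
projective family `f : 𝒳 ⟶ S` over a smooth, quasi-projective, irreducible base `S` and a CONTINUOUS
section `σ : S(ℂ) → FiberClass f k` of the espace étalé of `Rᵏ f_* ℂ` (`FiberClass.pt ∘ σ = id`),
if the value `σ(s₁) ∈ Hᵏ(X_{s₁}(ℂ); ℂ)` is a rational class (`IsRationalClass`: image of
`Hᵏ(·; ℚ)`) at ONE point `s₁`, then `σ(s)` is rational at EVERY point `s ∈ S(ℂ)`.

Proof (assembly of PROVED tree theorems, Voisin I §9.2.1 / Voisin II Lemma 4.17):

* `S(ℂ)` is connected (`S` irreducible and locally of finite type: SGA1 XII 2.4,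
  `Motives.ComplexPoints.connectedSpace_iff_holds`), so the smooth `S` is smooth of ONE relative
  dimension `d` (`exists_smoothOfRelativeDimension_of_connectedSpace_complexPoints`) and `S(ℂ)` is a
  connected real `2d`-manifold, hence path connected
  (`pathConnectedSpace_complexPoints_of_smoothOfRelativeDimension`);
* `f` is homotopically locally trivial over all of `S(ℂ)` (Ehresmann on complex points,
  `isHomotopicallyLocallyTrivialOn_univ`), hence cohomologically locally trivial
  (`IsHomotopicallyLocallyTrivialOn.isCohomologicallyLocallyTrivialOn`), so parallel transport
  `transportFun` in the local system `Rᵏ f_* ℂ` is available over `univ`, and over the trivialising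
  tubes (retracting onto each fibre) a tube class with one rational restriction is rational
  (`isRationalClass_of_homotopyEquiv`) — the rational-descent hypothesis `hrat` of
  `isRationalClass_transportFun`;
* continuous sections are flat (`transportFun_clsAt_of_continuous`): transport along a path from `s₁`
  to `s` carries `σ(s₁)` to `σ(s)`; transport preserves rational classes
  (`isRationalClass_transportFun`).

No named fact is used; the hypothesis `Smooth S.hom` enters through the equidimensionality step.
-/

noncomputable section
-- every declaration of this problem lives in Summit.HodgeConjecture.HodgeConjecture.… (summit = sub-problem)
set_option linter.dupNamespace false

open CategoryTheory AlgebraicGeometry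
open Literature.AlgebraicGeometry

namespace Summit.HodgeConjecture.HodgeConjecture.Theorems.HeckePrymWeilLine

open Literature.AlgebraicGeometry.Motives Literature.AlgebraicGeometry.HodgeTheory
open Literature.AlgebraicTopology.SingularHomology

/-- Rationality of the class of a fibre class does not depend on the fibre `Hᵏ(X_t)`, `t = x.pt`,
in which it is viewed (`FiberClass.clsAt` is transport along an equality of base points). [folklore] -/
theorem ras_isRationalClass_clsAt_iff {𝒳 S : SchemeOver ℂ} {f : 𝒳 ⟶ S} {k : ℕ} (x : FiberClass f k)
    {t : ComplexPoints S} (h : x.pt = t) :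
    IsRationalClass (x.clsAt h) ↔ IsRationalClass x.cls := by
  subst h
  rfl

/-- **Rational descent over trivialising tubes from homotopical local triviality**: every point of a
homotopically locally trivial locus `U` has an open neighbourhood `B ⊆ U` over which restriction to
each fibre is bijective in all degrees (homotopy invariance) and a tube class with a rational
restriction to one fibre is rational (pull back along the homotopy inverse) — the hypothesis `hrat`
of `isRationalClass_transportFun`. [cite: VoisinHodgeI2002, §9.2.1] -/
theorem ras_hrat_of_isHomotopicallyLocallyTrivialOn {𝒳 S : SchemeOver ℂ} (f : 𝒳 ⟶ S)
    {U : Set (ComplexPoints S)} (hU : IsHomotopicallyLocallyTrivialOn f U) :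
    ∀ ⦃t : ComplexPoints S⦄, t ∈ U → ∃ B : Set (ComplexPoints S),
      IsOpen B ∧ t ∈ B ∧ B ⊆ U ∧
      (∀ (j : ℕ) ⦃s : ComplexPoints S⦄ (hs : s ∈ B), Function.Bijective (fiberRestrict f hs j)) ∧
      ∀ (j : ℕ) ⦃s : ComplexPoints S⦄ (hs : s ∈ B) (ξ : singularCohomology ℂ ℂ (tubeOver f B) j),
        IsRationalClass (fiberRestrict f hs j ξ) → IsRationalClass ξ := by
  intro t ht
  obtain ⟨B, hBo, htB, -, hBU, he⟩ := hU.exists_nhds_homotopyEquiv ht Set.univ Filter.univ_mem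
  refine ⟨B, hBo, htB, hBU, fun j s hs ↦ ?_, fun j s hs ξ hξ ↦ ?_⟩
  · obtain ⟨e, he⟩ := he hs
    exact (IsSpecialisingNhd.of_homotopyEquiv hBo hs e he j).bijective
  · obtain ⟨e, he⟩ := he hs
    exact isRationalClass_of_homotopyEquiv f hs e he ξ hξ

/-- **A smooth projective family over a quasi-projective base smooth of pure dimension `d` is
homotopically locally trivial over all of `S(ℂ)`** (Ehresmann's theorem on complex points,
`isHomotopicallyLocallyTrivialOn_univ`, with the instances a quasi-projective base supplies:
locally of finite type, separated, quasi-compact). [cite: VoisinHodgeI2002, Thm. 9.3 and §9.2.1] -/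
theorem ras_isHomotopicallyLocallyTrivialOn_univ {𝒳 S : SchemeOver ℂ} (f : 𝒳 ⟶ S) {n : ℕ} (d : ℕ)
    (hf : IsSmoothProjectiveFamily f n) (hS : IsQuasiProjectiveOver S)
    [SmoothOfRelativeDimension d S.hom] :
    IsHomotopicallyLocallyTrivialOn f (Set.univ : Set (ComplexPoints S)) := by
  haveI : LocallyOfFiniteType S.hom := hS.locallyOfFiniteType
  haveI : IsSeparated S.hom := hS.isVarietyPair_ofScheme.isSeparated
  haveI : QuasiCompact S.hom := hS.isVarietyPair_ofScheme.quasiCompact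
  haveI : CompactSpace S.left := QuasiCompact.compactSpace_of_compactSpace S.hom
  haveI := hf.smoothOfRelativeDimension
  haveI := hf.isProper
  exact isHomotopicallyLocallyTrivialOn_univ f n d

/-- **Stub G2 — rationality along a flat section.** For a smooth projective family `f : 𝒳 ⟶ S` over
a smooth quasi-projective irreducible `S` and a continuous section `σ` of the espace étalé
`FiberClass f k → S(ℂ)` of `Rᵏ f_* ℂ`: if `σ(s₁)` is a rational class for one `s₁ ∈ S(ℂ)` then
`σ(s)` is rational for every `s ∈ S(ℂ)`. `S(ℂ)` is path connected (irreducible ⟹ connected complex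
points, smooth ⟹ manifold); `Rᵏ f_* ℂ` is a local system over `S(ℂ)` (Ehresmann + homotopy
invariance); a continuous section is flat, so `σ(s)` is the transport of `σ(s₁)` along any path, and
transport preserves rational classes (rational descent over tubes retracting onto their fibres).
[cite: VoisinHodgeII2003, Lemma 4.17 and §3.1.2] [cite: VoisinHodgeI2002, Thm. 9.3 and §9.2.1] -/
theorem stub_rationalAlongSection :
    ∀ ⦃𝒳 S : SchemeOver ℂ⦄ (f : 𝒳 ⟶ S) (n k : ℕ), IsSmoothProjectiveFamily f n →
      AlgebraicGeometry.Smooth S.hom → IsQuasiProjectiveOver S → IrreducibleSpace S.left →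
      ∀ (σ : ComplexPoints S → FiberClass f k), Continuous σ → (∀ s, (σ s).pt = s) →
        ∀ s₁ : ComplexPoints S, IsRationalClass (σ s₁).cls → ∀ s, IsRationalClass (σ s).cls := by
  intro 𝒳 S f n k hf hSsm hSqp hSirr σ hσ hpt s₁ h₁ s
  haveI := hSsm
  haveI := hSirr
  haveI : LocallyOfFiniteType S.hom := hSqp.locallyOfFiniteType
  haveI : ConnectedSpace (ComplexPoints S) :=
    (Motives.ComplexPoints.connectedSpace_iff_holds S).2 inferInstance
  obtain ⟨d, hd⟩ := exists_smoothOfRelativeDimension_of_connectedSpace_complexPoints S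
  haveI := hd
  haveI := pathConnectedSpace_complexPoints_of_smoothOfRelativeDimension S d
  -- `Rᵏ f_* ℂ` is a local system over all of `S(ℂ)`, with rational descent over small tubes
  have hH := ras_isHomotopicallyLocallyTrivialOn_univ f d hf hSqp
  have hU : IsCohomologicallyLocallyTrivialOn f (Set.univ : Set (ComplexPoints S)) :=
    hH.isCohomologicallyLocallyTrivialOn
  -- a path from `s₁` to `s`, viewed in the subtype `univ`
  have hι : Continuous fun x : ComplexPoints S ↦
      (⟨x, Set.mem_univ x⟩ : (Set.univ : Set (ComplexPoints S))) :=
    continuous_id.subtype_mk _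
  let γ : Path (⟨s₁, Set.mem_univ s₁⟩ : (Set.univ : Set (ComplexPoints S))) ⟨s, Set.mem_univ s⟩ :=
    (PathConnectedSpace.somePath s₁ s).map hι
  -- continuous sections are flat: transport along `γ` carries `σ(s₁)` to `σ(s)`
  have hflat : transportFun f k hU ⟦γ⟧ ((σ s₁).clsAt (hpt s₁)) = (σ s).clsAt (hpt s) :=
    transportFun_clsAt_of_continuous f k hU hσ hpt γ
  -- transport preserves rational classes
  have hrat : IsRationalClass (transportFun f k hU ⟦γ⟧ ((σ s₁).clsAt (hpt s₁))) :=
    isRationalClass_transportFun f k hU (ras_hrat_of_isHomotopicallyLocallyTrivialOn f hH) ⟦γ⟧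
      ((ras_isRationalClass_clsAt_iff (σ s₁) (hpt s₁)).2 h₁)
  rw [hflat] at hrat
  exact (ras_isRationalClass_clsAt_iff (σ s) (hpt s)).1 hrat

end Summit.HodgeConjecture.HodgeConjecture.Theorems.HeckePrymWeilLine

end
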